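import Summits.QuantumAdvantage.QuantumAdvantage.Theorems.WildDialDollA

/-! # WildDialDollB — part 2/4 (mechanical split for landing of `WildDialDoll`; content verbatim; scopes re-opened with their variables) -/

set_option linter.dupNamespace false

namespace Summit.QuantumAdvantage.QuantumAdvantage.Theorems.WildDialDoll
open Finset
open Summit.QuantumAdvantage.AdviceFreeQNC0
open Summit.QuantumAdvantage.AdviceFreeQNC0.Fib19
open Literature.Computability.QuantumComplexity
open Literature.Computability.QuantumComplexity.RingHLF
open Literature.Computability.MetaComplexity

section DollEvent

variable {n m : ℕ}

/-- `(a − 1)² = [a ≠ 1]` in `𝔽₃`. [bookkeeping] -/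
theorem sq_sub_one_table : ∀ a : ZMod 3, (a - 1) * (a - 1) = if a = 1 then 0 else 1 := by decide

/-- **EVENT FORM.** If the EVENT `[P = 1]` of a degree-`D` polynomial agrees with a Boolean function `f` on all `2^m` doll
points and `m > 2D`, then `Σ_S (−1)^{|S|} [f(x^S) = 0] ≡ 0 (mod 3)` — apply the annihilator to `(P − 1)²`, of degree `≤ 2D`.
Contrapositive: a Boolean function whose doll functional is non-zero is not a degree-`D` event on the doll. [PROVED] -/
theorem dollSum_event (x : Fin n → Bool) (T : Fin m → Finset (Fin n)) (hT : Pairwise fun k l => Disjoint (T k) (T l))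
    {D : ℕ} (h2D : 2 * D < m) {P : Smolensky.CubeFn (ZMod 3) n} (hP : P ∈ Smolensky.lowDeg (ZMod 3) n D)
    (f : (Fin n → Bool) → Bool) (hf : ∀ S : Finset (Fin m), decide (P (dollPt x T S) = 1) = f (dollPt x T S)) :
    ∑ S : Finset (Fin m), (-1 : ZMod 3) ^ S.card * (if f (dollPt x T S) = true then (0 : ZMod 3) else 1) = 0 := by
  have h1 := one_mem_lowDeg n D
  have hQ : (P - 1) * (P - 1) ∈ Smolensky.lowDeg (ZMod 3) n (2 * D) := by
    rw [two_mul]; exact Smolensky.mul_mem_lowDeg_add (Submodule.sub_mem _ hP h1) (Submodule.sub_mem _ hP h1)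
  have h0 := dollSum_eq_zero_of_mem_lowDeg x T hT h2D hQ
  unfold dollSum at h0
  refine Eq.trans (Finset.sum_congr rfl fun S _ => ?_) h0
  congr 1
  rw [Pi.mul_apply, Pi.sub_apply, Pi.one_apply, sq_sub_one_table]
  have hS := hf S
  by_cases hP1 : P (dollPt x T S) = 1
  · have hft : f (dollPt x T S) = true := by rw [← hS]; exact decide_eq_true hP1
    rw [if_pos hft, if_pos hP1]
  · have hff : f (dollPt x T S) = false := by rw [← hS]; exact decide_eq_false hP1
    rw [hff, if_neg hP1]; simp
/-- **DOLL WITNESS for `CanonCoinAt n d`** (pin `0`): `2d+1` pairwise disjoint flip sets such that every doll point is odd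
with `J_0 = 1` (co-pin class) and the doll functional of the oracle bit is non-zero mod `3`.  A finite, DECIDABLE object at
each `n`, transported `n ↦ n + 3` by period-3 padding (§4a), so three consecutive certified lengths give all larger `n`
(numerically: 32 witnesses among the `2^{11}` odd bases at `n = 12, d = 2`; NONE for adjacent or interleaved pairs over all `2^{11}` bases —
nesting is essential, NODE-g5.md §3). [NEW object] -/
def DollWitness (n d : ℕ) (x : Fin n → Bool) (T : Fin (2 * d + 1) → Finset (Fin n)) : Prop :=
  ∃ h3 : 3 ≤ n,
    (∀ k l : Fin (2 * d + 1), k ≠ l → Disjoint (T k) (T l)) ∧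
    (∀ S : Finset (Fin (2 * d + 1)), IsOdd (dollPt x T S) ∧ kline (dollPt x T S) (⟨0, by omega⟩ : Fin n) = true) ∧
    (∑ S : Finset (Fin (2 * d + 1)), (-1 : ZMod 3) ^ S.card *
        (if oracleBit (⟨0, by omega⟩ : Fin n) (dollPt x T S) = true then (0 : ZMod 3) else 1)) ≠ 0
/-- **REDUCTION: a doll witness certifies `CanonCoinAt n d`.** If `[P₀ = 1]` made the canonical one-wild strategy perfect,
it would agree with the oracle bit on the co-pin class (`canon_perfect_iff`), in particular on every doll point, and the
event form of the annihilator (`2d+1 > 2d`) would force the doll functional of the oracle bit to vanish. [PROVED] -/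
theorem canonCoinAt_of_dollWitness {n d : ℕ} {x : Fin n → Bool} {T : Fin (2 * d + 1) → Finset (Fin n)}
    (hW : DollWitness n d x T) : CanonCoinAt n d := by
  obtain ⟨h3, hT, hpts, hsum⟩ := hW
  intro h3' P₀ hP₀
  by_contra hno
  push Not at hno
  have hperf : ∀ y : Fin n → Bool, IsOdd y →
      Rel y (canonStrat (⟨0, by omega⟩ : Fin n) (fun y => decide (P₀ y = 1)) y) :=
    fun y hy => hno y ((isOdd_iff_oddZeros y).1 hy)
  have hforced := (canon_perfect_iff h3 (⟨0, by omega⟩ : Fin n) (fun y => decide (P₀ y = 1))).1 hperf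
  exact hsum (dollSum_event x T (fun k l hkl => hT k l hkl) (by omega) hP₀ (oracleBit (⟨0, by omega⟩ : Fin n))
    fun S => hforced _ (hpts S).1 (hpts S).2)

end DollEvent


/-! ### §4a Period-3 padding: doll witnesses transport `n ↦ n + 3` (the kernel line along a block `111` runs one full period) -/

section Pad

variable {n : ℕ}
/-- Pad a pattern with a block `111` at the end of the ring (between position `n − 1` and position `0`). [NEW object] -/
def pad3 (x : Fin n → Bool) : Fin (n + 3) → Bool := fun i => if h : i.val < n then x ⟨i.val, h⟩ else true
/-- The kernel vector of the padded pattern: the old kernel line, continued along the three new `1`s by the Fibonacci rule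
`v_{b+1} = v_{b-1} ⊕ v_b` — one full period `(v₀, v_{n-1} ⊕ v₀, v_{n-1})`, landing back on `v₀`. [NEW object] -/
def padVec (hn : 3 ≤ n) (v : Fin n → Bool) : Fin (n + 3) → Bool := fun i =>
  if hi : i.val < n then v ⟨i.val, hi⟩
  else if i.val = n then v ⟨0, by omega⟩
  else if i.val = n + 1 then xor (v ⟨n - 1, by omega⟩) (v ⟨0, by omega⟩)
  else v ⟨n - 1, by omega⟩
/-- WildDial doll helper `pad3_apply_lt` (lens-1 g5 WildDialDoll; see the enclosing section docstring). -/
theorem pad3_apply_lt (x : Fin n → Bool) {i : ℕ} (hi : i < n) (h' : i < n + 3) : pad3 x ⟨i, h'⟩ = x ⟨i, hi⟩ := by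
  dsimp only [pad3]; rw [dif_pos hi]
/-- WildDial doll helper `pad3_apply_ge` (lens-1 g5 WildDialDoll; see the enclosing section docstring). -/
theorem pad3_apply_ge (x : Fin n → Bool) {i : ℕ} (hi : n ≤ i) (h' : i < n + 3) : pad3 x ⟨i, h'⟩ = true := by
  dsimp only [pad3]; rw [dif_neg (by omega)]
/-- WildDial doll helper `padVec_apply_lt` (lens-1 g5 WildDialDoll; see the enclosing section docstring). -/
theorem padVec_apply_lt (hn : 3 ≤ n) (v : Fin n → Bool) {i : ℕ} (hi : i < n) (h' : i < n + 3) :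
    padVec hn v ⟨i, h'⟩ = v ⟨i, hi⟩ := by
  dsimp only [padVec]; rw [dif_pos hi]
/-- WildDial doll helper `padVec_apply_n` (lens-1 g5 WildDialDoll; see the enclosing section docstring). -/
theorem padVec_apply_n (hn : 3 ≤ n) (v : Fin n → Bool) (h' : n < n + 3) :
    padVec hn v ⟨n, h'⟩ = v ⟨0, by omega⟩ := by
  dsimp only [padVec]; rw [dif_neg (lt_irrefl n), if_pos rfl]
/-- WildDial doll helper `padVec_apply_n1` (lens-1 g5 WildDialDoll; see the enclosing section docstring). -/
theorem padVec_apply_n1 (hn : 3 ≤ n) (v : Fin n → Bool) (h' : n + 1 < n + 3) :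
    padVec hn v ⟨n + 1, h'⟩ = xor (v ⟨n - 1, by omega⟩) (v ⟨0, by omega⟩) := by
  dsimp only [padVec]; rw [dif_neg (by omega), if_neg (by omega), if_pos rfl]
/-- WildDial doll helper `padVec_apply_n2` (lens-1 g5 WildDialDoll; see the enclosing section docstring). -/
theorem padVec_apply_n2 (hn : 3 ≤ n) (v : Fin n → Bool) (h' : n + 2 < n + 3) :
    padVec hn v ⟨n + 2, h'⟩ = v ⟨n - 1, by omega⟩ := by
  dsimp only [padVec]; rw [dif_neg (by omega), if_neg (by omega), if_neg (by omega)]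
/-- `nxt ⟨k⟩ = ⟨k + 1⟩` away from the seam. [bookkeeping] -/
theorem nxt_of_succ {N k k' : ℕ} (e : k + 1 = k') (hk' : k' < N) : nxt (⟨k, by omega⟩ : Fin N) = ⟨k', hk'⟩ :=
  Fin.ext (by subst e; simp [nxt, Nat.mod_eq_of_lt hk'])
/-- `nxt ⟨N − 1⟩ = ⟨0⟩`. [bookkeeping] -/
theorem nxt_of_wrap {N k : ℕ} (e : k + 1 = N) (hN : 0 < N) : nxt (⟨k, by omega⟩ : Fin N) = ⟨0, hN⟩ :=
  Fin.ext (by subst e; simp [nxt])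
/-- `prv ⟨k' + 1⟩ = ⟨k'⟩`. [bookkeeping] -/
theorem prv_of_succ {N k k' : ℕ} (e : k' + 1 = k) (hk : k < N) : prv (⟨k, hk⟩ : Fin N) = ⟨k', by omega⟩ := by
  rw [← nxt_of_succ e hk, prv_nxt]
/-- `prv ⟨0⟩ = ⟨N − 1⟩`. [bookkeeping] -/
theorem prv_of_wrap {N k' : ℕ} (e : k' + 1 = N) (hN : 0 < N) : prv (⟨0, hN⟩ : Fin N) = ⟨k', by omega⟩ := by
  rw [← nxt_of_wrap e hN, prv_nxt]

/-- **The padded kernel vector lies in the kernel of the padded pattern** (six seam cases; the three new equations are the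
Fibonacci period `(a, b) ↦ (b, a ⊕ b) ↦ (a ⊕ b, a) ↦ (a, b)`). [PROVED] -/
theorem inKernel_pad3 (hn : 3 ≤ n) {x v : Fin n → Bool} (hK : InKernel x v) : InKernel (pad3 x) (padVec hn v) := by
  intro b
  obtain ⟨k, hk⟩ := b
  have hcases : k = 0 ∨ (∃ j, k = j + 1 ∧ j + 3 ≤ n) ∨ k = n - 1 ∨ k = n ∨ k = n + 1 ∨ k = n + 2 := by
    by_cases h0 : k = 0
    · exact Or.inl h0
    · by_cases h1 : k + 2 ≤ n
      · exact Or.inr (Or.inl ⟨k - 1, by omega, by omega⟩)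
      · right; right; omega
  rcases hcases with e | ⟨j, e, hj⟩ | e | e | e | e
  · -- k = 0
    have eb : (⟨k, hk⟩ : Fin (n + 3)) = ⟨0, by omega⟩ := Fin.ext e
    have h := hK ⟨0, by omega⟩
    rw [prv_of_wrap (k' := n - 1) (by omega), nxt_of_succ (k := 0) (k' := 1) rfl (by omega)] at h
    rw [eb, prv_of_wrap (k' := n + 2) (by omega), nxt_of_succ (k := 0) (k' := 1) rfl (by omega), padVec_apply_n2,
      padVec_apply_lt hn v (by omega), padVec_apply_lt hn v (by omega), pad3_apply_lt x (by omega)]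
    exact h
  · -- interior: k = j + 1 with j + 3 ≤ n
    have eb : (⟨k, hk⟩ : Fin (n + 3)) = ⟨j + 1, by omega⟩ := Fin.ext e
    have h := hK ⟨j + 1, by omega⟩
    rw [prv_of_succ (k := j + 1) (k' := j) rfl, nxt_of_succ (k := j + 1) (k' := j + 2) rfl (by omega)] at h
    rw [eb, prv_of_succ (k := j + 1) (k' := j) rfl, nxt_of_succ (k := j + 1) (k' := j + 2) rfl (by omega),
      padVec_apply_lt hn v (by omega), padVec_apply_lt hn v (by omega), padVec_apply_lt hn v (by omega),
      pad3_apply_lt x (by omega)]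
    exact h
  · -- k = n - 1
    have eb : (⟨k, hk⟩ : Fin (n + 3)) = ⟨n - 1, by omega⟩ := Fin.ext e
    have h := hK ⟨n - 1, by omega⟩
    rw [prv_of_succ (k := n - 1) (k' := n - 2) (by omega), nxt_of_wrap (k := n - 1) (by omega) (by omega)] at h
    rw [eb, prv_of_succ (k := n - 1) (k' := n - 2) (by omega), nxt_of_succ (k := n - 1) (k' := n) (by omega) (by omega),
      padVec_apply_lt hn v (by omega), padVec_apply_n, padVec_apply_lt hn v (by omega), pad3_apply_lt x (by omega)]
    exact h
  · -- k = n
    have eb : (⟨k, hk⟩ : Fin (n + 3)) = ⟨n, by omega⟩ := Fin.ext e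
    rw [eb, prv_of_succ (k := n) (k' := n - 1) (by omega), nxt_of_succ (k := n) (k' := n + 1) rfl (by omega),
      padVec_apply_lt hn v (by omega), padVec_apply_n1, padVec_apply_n, pad3_apply_ge x le_rfl]
    cases v ⟨n - 1, _⟩ <;> cases v ⟨0, _⟩ <;> rfl
  · -- k = n + 1
    have eb : (⟨k, hk⟩ : Fin (n + 3)) = ⟨n + 1, by omega⟩ := Fin.ext e
    rw [eb, prv_of_succ (k := n + 1) (k' := n) rfl, nxt_of_succ (k := n + 1) (k' := n + 2) rfl (by omega),
      padVec_apply_n, padVec_apply_n2, padVec_apply_n1, pad3_apply_ge x (by omega)]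
    cases v ⟨n - 1, _⟩ <;> cases v ⟨0, _⟩ <;> rfl
  · -- k = n + 2
    have eb : (⟨k, hk⟩ : Fin (n + 3)) = ⟨n + 2, by omega⟩ := Fin.ext e
    rw [eb, prv_of_succ (k := n + 2) (k' := n + 1) rfl, nxt_of_wrap (k := n + 2) (by omega) (by omega),
      padVec_apply_n1, padVec_apply_lt hn v (by omega), padVec_apply_n2, pad3_apply_ge x (by omega)]
    cases v ⟨n - 1, _⟩ <;> cases v ⟨0, _⟩ <;> rfl

/-- Padding keeps the number of zeros. [bookkeeping] -/
theorem zeros_pad3 (x : Fin n → Bool) : zeros (pad3 x) = zeros x := by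
  unfold zeros
  rw [Finset.card_filter, Finset.card_filter, Fin.sum_univ_add]
  have h2 : ∑ j : Fin 3, (if pad3 x (Fin.natAdd n j) = false then 1 else 0) = 0 := by
    refine Finset.sum_eq_zero fun j _ => ?_
    have : pad3 x (Fin.natAdd n j) = true := by
      rw [show Fin.natAdd n j = ⟨n + j.val, by omega⟩ from Fin.ext (by simp), pad3_apply_ge x (by omega)]
    simp [this]
  rw [h2, add_zero]
  refine Finset.sum_congr rfl fun i _ => ?_
  rw [show Fin.castAdd 3 i = ⟨i.val, by omega⟩ from Fin.ext (by simp), pad3_apply_lt x i.isLt]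

/-- Padding keeps the odd class. [PROVED] -/
theorem isOdd_pad3 (x : Fin n → Bool) : IsOdd (pad3 x) ↔ IsOdd x := by
  rw [isOdd_iff, isOdd_iff, zeros_pad3]

/-- **The kernel line of the padded pattern is the padded kernel line** (uniqueness principle). [PROVED] -/
theorem kline_pad3 (hn : 3 ≤ n) (x : Fin n → Bool) (hodd : IsOdd x) : kline (pad3 x) = padVec hn (kline x) := by
  have hodd' : IsOdd (pad3 x) := (isOdd_pad3 x).2 hodd
  obtain ⟨i, hi⟩ := (kline_hardCore hn x hodd).2
  have hne : padVec hn (kline x) ≠ fun _ => false := by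
    refine ne_zero_of_apply_eq_true (i := ⟨i.val, by omega⟩) ?_
    rw [padVec_apply_lt hn _ i.isLt]; exact hi
  exact (kline_eq_iff_inKernel (by omega) _ hodd' hne).2 (inKernel_pad3 hn (kline_inKernel hn x hodd))

/-- Padding keeps the coin status of every old position. [PROVED] -/
theorem kline_pad3_apply (hn : 3 ≤ n) (x : Fin n → Bool) (hodd : IsOdd x) {i : ℕ} (hi : i < n) (h' : i < n + 3) :
    kline (pad3 x) ⟨i, h'⟩ = kline x ⟨i, hi⟩ := by
  rw [kline_pad3 hn x hodd, padVec_apply_lt hn _ hi]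

/-- Padding keeps the canonical guess at position `0`. [bookkeeping] -/
theorem tGuess_pad3_zero (hn : 3 ≤ n) (x : Fin n → Bool) :
    tGuess (pad3 x) ⟨0, by omega⟩ = tGuess x ⟨0, by omega⟩ := by
  unfold tGuess
  rw [nxt_of_succ (k := 0) (k' := 1) rfl (by omega), nxt_of_succ (k := 0) (k' := 1) rfl (by omega),
    pad3_apply_lt x (by omega), pad3_apply_lt x (by omega)]

/-- Padding keeps the oracle bit at pin `0` (on odd patterns). [PROVED] -/
theorem oracleBit_pad3_zero (hn : 3 ≤ n) (x : Fin n → Bool) (hodd : IsOdd x) :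
    oracleBit (⟨0, by omega⟩ : Fin (n + 3)) (pad3 x) = oracleBit (⟨0, by omega⟩ : Fin n) x := by
  unfold oracleBit
  rw [tGuess_pad3_zero hn, nxt_of_succ (k := 0) (k' := 1) rfl (by omega), nxt_of_succ (k := 0) (k' := 1) rfl (by omega),
    kline_pad3_apply hn x hodd (by omega)]

/-- Padding commutes with flips on old positions. [bookkeeping] -/
theorem pad3_flipAt (x : Fin n → Bool) (A : Finset (Fin n)) :
    pad3 (flipAt x A) = flipAt (pad3 x) (A.image (Fin.castLE (by omega : n ≤ n + 3))) := by
  funext i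
  obtain ⟨k, hk⟩ := i
  have hmem : ((⟨k, hk⟩ : Fin (n + 3)) ∈ A.image (Fin.castLE (by omega : n ≤ n + 3))) ↔ ∃ h : k < n, (⟨k, h⟩ : Fin n) ∈ A := by
    rw [Finset.mem_image]
    constructor
    · rintro ⟨a, ha, hak⟩
      have : a.val = k := by simpa using congrArg Fin.val hak
      subst this
      exact ⟨a.isLt, ha⟩
    · rintro ⟨h, ha⟩
      exact ⟨⟨k, h⟩, ha, Fin.ext (by simp)⟩
  by_cases h : k < n
  · unfold flipAt
    rw [pad3_apply_lt _ h, pad3_apply_lt _ h]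
    congr 1
    rw [decide_eq_decide, hmem]
    exact ⟨fun ha => ⟨h, ha⟩, fun ⟨_, ha⟩ => ha⟩
  · unfold flipAt
    rw [pad3_apply_ge _ (by omega), pad3_apply_ge _ (by omega)]
    have : ¬ ((⟨k, hk⟩ : Fin (n + 3)) ∈ A.image (Fin.castLE (by omega : n ≤ n + 3))) := fun hm => h (hmem.1 hm).1
    simp [this]

/-- The padded doll. [bookkeeping] -/
def padDoll {m : ℕ} (T : Fin m → Finset (Fin n)) : Fin m → Finset (Fin (n + 3)) :=
  fun k => (T k).image (Fin.castLE (by omega : n ≤ n + 3))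

/-- Doll points of the padded doll are padded doll points. [bookkeeping] -/
theorem dollPt_pad3 {m : ℕ} (x : Fin n → Bool) (T : Fin m → Finset (Fin n)) (S : Finset (Fin m)) :
    dollPt (pad3 x) (padDoll T) S = pad3 (dollPt x T S) := by
  unfold dollPt padDoll
  rw [pad3_flipAt]
  congr 1
  ext i
  simp only [Finset.mem_image, Finset.mem_biUnion]
  constructor
  · rintro ⟨k, hk, a, ha, rfl⟩; exact ⟨a, ⟨k, hk, ha⟩, rfl⟩
  · rintro ⟨a, ⟨k, hk, ha⟩, rfl⟩; exact ⟨k, hk, a, ha, rfl⟩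

/-- **TRANSPORT OF DOLL WITNESSES `n ↦ n + 3`.** [PROVED] -/
theorem dollWitness_pad3 {d : ℕ} {x : Fin n → Bool} {T : Fin (2 * d + 1) → Finset (Fin n)}
    (hW : DollWitness n d x T) : DollWitness (n + 3) d (pad3 x) (padDoll T) := by
  obtain ⟨h3, hT, hpts, hsum⟩ := hW
  refine ⟨by omega, fun k l hkl => ?_, fun S => ?_, ?_⟩
  · unfold padDoll
    exact (Finset.disjoint_image (Fin.castLE_injective _)).2 (hT k l hkl)
  · rw [dollPt_pad3, isOdd_pad3, kline_pad3_apply h3 _ (hpts S).1 (by omega)]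
    exact hpts S
  · rw [show (∑ S : Finset (Fin (2 * d + 1)), (-1 : ZMod 3) ^ S.card *
        (if oracleBit (⟨0, by omega⟩ : Fin (n + 3)) (dollPt (pad3 x) (padDoll T) S) = true then (0 : ZMod 3) else 1)) =
      ∑ S : Finset (Fin (2 * d + 1)), (-1 : ZMod 3) ^ S.card *
        (if oracleBit (⟨0, by omega⟩ : Fin n) (dollPt x T S) = true then (0 : ZMod 3) else 1) from
      Finset.sum_congr rfl fun S _ => by rw [dollPt_pad3, oracleBit_pad3_zero h3 _ (hpts S).1]]
    exact hsum

/-- Existence of doll witnesses transports `n ↦ n + 3`. [PROVED] -/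
theorem exists_dollWitness_add_three {d : ℕ} (h : ∃ (x : Fin n → Bool) (T : Fin (2 * d + 1) → Finset (Fin n)), DollWitness n d x T) :
    ∃ (x : Fin (n + 3) → Bool) (T : Fin (2 * d + 1) → Finset (Fin (n + 3))), DollWitness (n + 3) d x T := by
  obtain ⟨x, T, hW⟩ := h
  exact ⟨pad3 x, padDoll T, dollWitness_pad3 hW⟩

end Pad

/-! ### §4 Kernel certificates at the base lengths (`decide +kernel` on the `2^{2d+1}` doll points) -/

/-- The base pattern of the `n = 12` doll (found by `g5/exp/doll.py`: `x = 010000010001`). -/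
def x12 : Fin 12 → Bool := ![false, true, false, false, false, false, false, true, false, false, false, true]

/-- The nested doll `T k = {2 + k, 11 − k}`, `k < 5`. -/
def T12 : Fin 5 → Finset (Fin 12) := ![{2, 11}, {3, 10}, {4, 9}, {5, 8}, {6, 7}]

/-- **KERNEL CERTIFICATE**: `(x12, T12)` is a doll witness at `n = 12`, `d = 2` (32 doll points, all odd with `J_0 = 1`,
doll functional of the oracle bit `≠ 0`). [PROVED by `decide`] -/
theorem dollWitness_twelve : DollWitness 12 2 x12 T12 := by
  unfold DollWitness
  refine ⟨by norm_num, ?_, ?_, ?_⟩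
  · decide +kernel
  · decide +kernel
  · decide +kernel

/-- **RUNG (kernel-certified): `CanonCoinAt 12 2`** — at ring length `12` no quadratic wild bit completes the canonical
affine base: the oracle bit `t(x)_0 ⊕ ¬J_1(x)` is not a degree-`2` `𝔽₃`-event on the co-pin class. This is an instance of
the `(2,1)`-cell OUTSIDE every proved regime (the wild output has unrestricted rank; `NoPerfectTwo3` at `n = 12` is open).
[PROVED] -/
theorem canonCoinAt_twelve_two : CanonCoinAt 12 2 := canonCoinAt_of_dollWitness dollWitness_twelve

/-- Base pattern of the `n = 13` doll (`doll.py 13 2`: `x = 1000111011110`). -/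
def x13 : Fin 13 → Bool := ![true, false, false, false, true, true, true, false, true, true, true, true, false]

/-- The nested doll `T k = {3 + k, 12 − k}`, `k < 5`, at `n = 13`. -/
def T13 : Fin 5 → Finset (Fin 13) := ![{3, 12}, {4, 11}, {5, 10}, {6, 9}, {7, 8}]

/-- Kernel certificate at `n = 13`, `d = 2`. [PROVED by `decide`] -/
theorem dollWitness_thirteen : DollWitness 13 2 x13 T13 := by
  unfold DollWitness
  refine ⟨by norm_num, ?_, ?_, ?_⟩
  · decide +kernel
  · decide +kernel
  · decide +kernel

/-- **RUNG `CanonCoinAt 13 2`.** [PROVED] -/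
theorem canonCoinAt_thirteen_two : CanonCoinAt 13 2 := canonCoinAt_of_dollWitness dollWitness_thirteen

/-- Base pattern of the `n = 14` doll (`doll.py 14 2`: `x = 10110011011101`). -/
def x14 : Fin 14 → Bool := ![true, false, true, true, false, false, true, true, false, true, true, true, false, true]

/-- The nested doll `T k = {4 + k, 13 − k}`, `k < 5`, at `n = 14`. -/
def T14 : Fin 5 → Finset (Fin 14) := ![{4, 13}, {5, 12}, {6, 11}, {7, 10}, {8, 9}]

/-- Kernel certificate at `n = 14`, `d = 2`. [PROVED by `decide`] -/
theorem dollWitness_fourteen : DollWitness 14 2 x14 T14 := by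
  unfold DollWitness
  refine ⟨by norm_num, ?_, ?_, ?_⟩
  · decide +kernel
  · decide +kernel
  · decide +kernel

/-- **RUNG `CanonCoinAt 14 2`** — with `n = 12, 13` one certified length in each residue class mod `3`, the bases of the
period-`3` padding argument (NODE-g5.md §3: inserting a block `111` at the end of the ring preserves the odd class, `J_0`, `J_1`
and `t_0` of every doll point, hence transports doll witnesses `n ↦ n + 3`). [PROVED] -/
theorem canonCoinAt_fourteen_two : CanonCoinAt 14 2 := canonCoinAt_of_dollWitness dollWitness_fourteen

/-- The base pattern of the `n = 16` cubic doll (found by `g5/exp/doll.py 16 3`: `x = 0101011110111011`). -/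
def x16 : Fin 16 → Bool :=
  ![false, true, false, true, false, true, true, true, true, false, true, true, true, false, true, true]

/-- The nested doll `T k = {2 + k, 15 − k}`, `k < 7`. -/
def T16 : Fin 7 → Finset (Fin 16) := ![{2, 15}, {3, 14}, {4, 13}, {5, 12}, {6, 11}, {7, 10}, {8, 9}]

/-- **KERNEL CERTIFICATE (cubic)**: `(x16, T16)` is a doll witness at `n = 16`, `d = 3` (128 doll points). [PROVED by `decide`] -/
theorem dollWitness_sixteen : DollWitness 16 3 x16 T16 := by
  unfold DollWitness
  refine ⟨by norm_num, ?_, ?_, ?_⟩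
  · decide +kernel
  · decide +kernel
  · decide +kernel

/-- **RUNG (kernel-certified): `CanonCoinAt 16 3`** — at ring length `16` no CUBIC wild bit completes the canonical affine
base. [PROVED] -/
theorem canonCoinAt_sixteen_three : CanonCoinAt 16 3 := canonCoinAt_of_dollWitness dollWitness_sixteen

/-- Base patterns and nested dolls for `d = 1` at `n = 8, 9, 10` and `d = 3` at `n = 17, 18` (`doll.py`). -/
def x8 : Fin 8 → Bool := ![false, true, false, false, true, false, false, true]
/-- WildDial doll helper `T8` (lens-1 g5 WildDialDoll; see the enclosing section docstring). -/
def T8 : Fin 3 → Finset (Fin 8) := ![{2, 7}, {3, 6}, {4, 5}]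
/-- WildDial doll helper `x9` (lens-1 g5 WildDialDoll; see the enclosing section docstring). -/
def x9 : Fin 9 → Bool := ![false, false, true, false, false, true, false, false, false]
/-- WildDial doll helper `T9` (lens-1 g5 WildDialDoll; see the enclosing section docstring). -/
def T9 : Fin 3 → Finset (Fin 9) := ![{3, 8}, {4, 7}, {5, 6}]
/-- WildDial doll helper `x10` (lens-1 g5 WildDialDoll; see the enclosing section docstring). -/
def x10 : Fin 10 → Bool := ![true, false, true, true, false, false, false, true, false, true]
/-- WildDial doll helper `T10` (lens-1 g5 WildDialDoll; see the enclosing section docstring). -/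
def T10 : Fin 3 → Finset (Fin 10) := ![{4, 9}, {5, 8}, {6, 7}]
/-- WildDial doll helper `x17` (lens-1 g5 WildDialDoll; see the enclosing section docstring). -/
def x17 : Fin 17 → Bool := ![true, false, false, true, false, true, true, false, true, false, true, true, false, true, true, false, true]
/-- WildDial doll helper `T17` (lens-1 g5 WildDialDoll; see the enclosing section docstring). -/
def T17 : Fin 7 → Finset (Fin 17) := ![{3, 16}, {4, 15}, {5, 14}, {6, 13}, {7, 12}, {8, 11}, {9, 10}]
/-- WildDial doll helper `x18` (lens-1 g5 WildDialDoll; see the enclosing section docstring). -/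
def x18 : Fin 18 → Bool := ![false, false, false, true, true, true, true, false, false, true, false, true, true, false, false, true, true, false]
/-- WildDial doll helper `T18` (lens-1 g5 WildDialDoll; see the enclosing section docstring). -/
def T18 : Fin 7 → Finset (Fin 18) := ![{4, 17}, {5, 16}, {6, 15}, {7, 14}, {8, 13}, {9, 12}, {10, 11}]

/-- WildDial doll helper `dollWitness_eight` (lens-1 g5 WildDialDoll; see the enclosing section docstring). -/
theorem dollWitness_eight : DollWitness 8 1 x8 T8 := by
  unfold DollWitness; refine ⟨by norm_num, ?_, ?_, ?_⟩ <;> decide +kernel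
/-- WildDial doll helper `dollWitness_nine` (lens-1 g5 WildDialDoll; see the enclosing section docstring). -/
theorem dollWitness_nine : DollWitness 9 1 x9 T9 := by
  unfold DollWitness; refine ⟨by norm_num, ?_, ?_, ?_⟩ <;> decide +kernel
/-- WildDial doll helper `dollWitness_ten` (lens-1 g5 WildDialDoll; see the enclosing section docstring). -/
theorem dollWitness_ten : DollWitness 10 1 x10 T10 := by
  unfold DollWitness; refine ⟨by norm_num, ?_, ?_, ?_⟩ <;> decide +kernel
/-- WildDial doll helper `dollWitness_seventeen` (lens-1 g5 WildDialDoll; see the enclosing section docstring). -/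
theorem dollWitness_seventeen : DollWitness 17 3 x17 T17 := by
  unfold DollWitness; refine ⟨by norm_num, ?_, ?_, ?_⟩ <;> decide +kernel
/-- WildDial doll helper `dollWitness_eighteen` (lens-1 g5 WildDialDoll; see the enclosing section docstring). -/
theorem dollWitness_eighteen : DollWitness 18 3 x18 T18 := by
  unfold DollWitness; refine ⟨by norm_num, ?_, ?_, ?_⟩ <;> decide +kernel


end Summit.QuantumAdvantage.QuantumAdvantage.Theorems.WildDialDoll
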